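import Literature.NumberTheory.LFunctions.ConreyIwaniec2002PrincipalEstimate
import HarnessLib

/-!
# Conrey–Iwaniec (2002), §10 with the `(log q)^{7/2}` principal estimate: Proposition 10.1 (weak)

Conrey–Iwaniec, Acta Arith. 103 (2002), §10, (10.2)–(10.13) [held text `paper:arxiv-math_0111012`,
p0021]. The tree's `conreyIwaniec2002_proposition101_of_proposition92` derives Proposition 10.1
from the typed Proposition 9.2 (middle term `T(log T)L(1,χ)^{1/2}(log q)^3`). The printed cosmetic
step (9.11) behind that exponent is not in print (OPEN leaf `Lq`, see
`ConreyIwaniec2002PrincipalEstimate.lean`); what the typed Proposition 9.1 yields unconditionally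
is the variant with `(log q)^{7/2}` (`conreyIwaniec2002_proposition92_weak_of_proposition91`).
Running §10 verbatim on that variant shifts the conclusion of Proposition 10.1 by half a power of
`log q` squared: `L(1,χ) ≥ (log T)^{−2}(log q)^{−2A−7}` instead of `−2A−6` (plan-1 A2.4).

PROVED HERE (no named fact, no new definition):
* `ConreyIwaniec2002.proposition101_weak_of_principalEstimate_weak` — (9.12) with `(log q)^{7/2}` ⟹
  Proposition 10.1 with `(log q)^{−(2A+7)}` (the printed (10.2)–(10.9) with `v = (log T)^{−1}(log q)^{−A−7/2}`);
* `conreyIwaniec2002_proposition101_weak_of_proposition91` — hence from the typed Proposition 9.1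
  ALONE (no `Lq`).

## References

* [ConreyIwaniec2002] B. Conrey, H. Iwaniec, Acta Arith. 103 (2002) 259–312, arXiv:math/0111012:
  Proposition 10.1 and its proof (10.2)–(10.9).
-/

noncomputable section

open scoped NumberField
open Complex

namespace Literature.NumberTheory.LFunctions

namespace ConreyIwaniec2002

open NumberField

/-- **Proposition 10.1 with `(log q)^{−(2A+7)}` from the principal estimate with `(log q)^{7/2}`**
(the printed §10 argument (10.2)–(10.9), term (ii) with `v = (log T)^{−1}(log q)^{−(A+7/2)}`).
[cite: ConreyIwaniec2002, Proposition 10.1 (proof, §10 (10.2)–(10.9))] -/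
theorem proposition101_weak_of_principalEstimate_weak
    (h : ∃ C : ℝ, 0 < C ∧
      ∀ (q : ℕ) [NeZero q], 4 < q → Odd q → ∀ χ : DirichletCharacter ℂ q,
        χ.IsPrimitive → χ.IsQuadratic → χ.Odd →
          ∀ (K : Type) [Field K] [NumberField K],
            Module.finrank ℚ K = 2 → NumberField.discr K = -(q : ℤ) →
              ∀ (ψ : ClassGroup (𝓞 K) →* ℂˣ) (T : ℝ) (S : Finset ℝ) (t' : ℝ → ℝ),
                2 ≤ T → IsPointSet S T →
                  ∑ t ∈ S, sincTerm t (t' t) ≤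
                    C * (T / Real.log T * Real.log q ^ (6 : ℕ) +
                      T * Real.log T * Real.sqrt ‖χ.LFunction 1‖ * Real.log q ^ ((7 : ℝ) / 2) +
                      Real.log q ^ ((5 : ℝ) / 2) / Real.log T *
                        Real.sqrt (T * ∑ t ∈ S, ‖dividedDifference (classGroupLFunction K ψ)
                          (1 / 2 + t * I) (1 / 2 + t' t * I)‖ ^ 2))) :
    ∃ c : ℝ, 0 < c ∧
    ∀ A : ℝ, 0 ≤ A →
      ∀ (q : ℕ) [NeZero q], 4 < q → Odd q → ∀ χ : DirichletCharacter ℂ q,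
        χ.IsPrimitive → χ.IsQuadratic → χ.Odd →
          ∀ (K : Type) [Field K] [NumberField K],
            Module.finrank ℚ K = 2 → NumberField.discr K = -(q : ℤ) →
              ∀ (ψ : ClassGroup (𝓞 K) →* ℂˣ) (T α : ℝ) (S : Finset ℝ) (t' : ℝ → ℝ),
                2 ≤ T → 0 < α → α ≤ 1 → Real.log q ^ (A + 6) ≤ Real.log T →
                  IsPointSet S T →
                    (∀ t ∈ S, |t - t' t| ≤ gapRadius α t) →
                      (∀ t ∈ S, ‖dividedDifference (classGroupLFunction K ψ)
                          (1 / 2 + t * I) (1 / 2 + t' t * I)‖ ≤ Real.log q ^ ((7 : ℝ) / 2)) →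
                        c * T / (α * Real.log q ^ A) ≤ (S.card : ℝ) →
                          Real.log T ^ (-(2 : ℝ)) * Real.log q ^ (-(2 * A + 7)) ≤
                            ‖χ.LFunction 1‖ := by
  classical
  obtain ⟨C, hC, hP⟩ := h
  refine ⟨4 * C, by positivity, fun A hA q _ hq hoddq χ hprim hquad hodd K _ _ h2 hdisc ψ T α S t'
    hT2 hα0 hα1 hlogTq hS h10 h11 h12 => ?_⟩
  have hq5 : (5 : ℝ) ≤ q := by exact_mod_cast hq
  have hℓ1 : 1 < Real.log q := by
    rw [Real.lt_log_iff_exp_lt (by linarith)]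
    exact Real.exp_one_lt_d9.trans_le (by linarith)
  set ℓ : ℝ := Real.log q with hℓdef
  have hℓ0 : 0 < ℓ := by linarith
  have hT0 : 0 < T := by linarith
  set Lt : ℝ := Real.log T with hLtdef
  -- `log T ≥ ℓ^{A+6} = ℓ^A ℓ^6 ≥ ℓ^A > 0`
  have hℓA : 0 < ℓ ^ A := Real.rpow_pos_of_pos hℓ0 A
  have hℓ6 : (1 : ℝ) ≤ ℓ ^ (6 : ℕ) := one_le_pow₀ hℓ1.le
  have hsplit : ℓ ^ (A + 6) = ℓ ^ A * ℓ ^ (6 : ℕ) := by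
    rw [Real.rpow_add hℓ0, show (6 : ℝ) = ((6 : ℕ) : ℝ) by norm_num, Real.rpow_natCast]
  have hLtA : ℓ ^ A * ℓ ^ (6 : ℕ) ≤ Lt := hsplit ▸ hlogTq
  have hLt0 : 0 < Lt := lt_of_lt_of_le (by positivity) hLtA
  have hℓnegA : ℓ ^ (-A) = (ℓ ^ A)⁻¹ := Real.rpow_neg hℓ0.le A
  -- the principal estimate
  have h92 := hP q hq hoddq χ hprim hquad hodd K h2 hdisc ψ T S t' hT2 hS
  -- lower bound (10.8): each summand is `≥ α`, and `α · #S ≥ 4C · T ℓ^{-A}` by (10.12)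
  have hlow : 4 * C * T * ℓ ^ (-A) ≤ ∑ t ∈ S, sincTerm t (t' t) := by
    have h1 : ∑ t ∈ S, α ≤ ∑ t ∈ S, sincTerm t (t' t) :=
      Finset.sum_le_sum fun t ht =>
        le_sincTerm_of_abs_sub_le hα0.le hα1 (by linarith [hS.two_le ht]) (h10 t ht)
    rw [Finset.sum_const, nsmul_eq_mul] at h1
    have h3 : 4 * C * T * ℓ ^ (-A) ≤ S.card * α := by
      rw [div_le_iff₀ (mul_pos hα0 hℓA)] at h12
      rw [hℓnegA, show 4 * C * T * (ℓ ^ A)⁻¹ = 4 * C * T / ℓ ^ A by rw [div_eq_mul_inv],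
        div_le_iff₀ hℓA]
      linarith
    linarith
  -- upper bound: if (10.13) failed, each term of (9.12) would be `≤ T ℓ^{-A}`
  by_contra hcon
  push Not at hcon
  -- `√‖L(1,χ)‖ < Lt⁻¹ ℓ^{-(A+7/2)}`
  set v : ℝ := Lt⁻¹ * ℓ ^ (-(A + 7 / 2)) with hvdef
  have hv0 : 0 < v := by positivity
  have hv2 : v ^ 2 = Lt ^ (-(2 : ℝ)) * ℓ ^ (-(2 * A + 7)) := by
    have h1 : (Lt⁻¹) ^ 2 = Lt ^ (-(2 : ℝ)) := by
      rw [Real.rpow_neg hLt0.le, Real.rpow_two, inv_pow]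
    have h2 : (ℓ ^ (-(A + 7 / 2))) ^ 2 = ℓ ^ (-(2 * A + 7)) := by
      rw [← Real.rpow_natCast (ℓ ^ (-(A + 7 / 2))) 2, ← Real.rpow_mul hℓ0.le]
      congr 1
      push_cast
      ring
    rw [hvdef, mul_pow, h1, h2]
  have hsqrt : Real.sqrt ‖χ.LFunction 1‖ < v := by
    rw [← Real.sqrt_sq hv0.le, hv2]
    exact Real.sqrt_lt_sqrt (norm_nonneg _) hcon
  -- term (i): `T ℓ^6 / Lt ≤ T ℓ^{-A}`
  have hterm1 : T / Lt * ℓ ^ (6 : ℕ) ≤ T * ℓ ^ (-A) := by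
    rw [hℓnegA, div_mul_eq_mul_div, div_le_iff₀ hLt0]
    calc T * ℓ ^ (6 : ℕ) = T * (ℓ ^ A)⁻¹ * (ℓ ^ A * ℓ ^ (6 : ℕ)) := by field_simp
      _ ≤ T * (ℓ ^ A)⁻¹ * Lt := mul_le_mul_of_nonneg_left hLtA (by positivity)
  -- term (ii): `T Lt √L(1,χ) ℓ^{7/2} ≤ T ℓ^{-A}`
  have hℓ720 : 0 < ℓ ^ ((7 : ℝ) / 2) := Real.rpow_pos_of_pos hℓ0 _
  have hterm2 : T * Lt * Real.sqrt ‖χ.LFunction 1‖ * ℓ ^ ((7 : ℝ) / 2) ≤ T * ℓ ^ (-A) := by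
    have h1 : T * Lt * Real.sqrt ‖χ.LFunction 1‖ * ℓ ^ ((7 : ℝ) / 2) ≤ T * Lt * v * ℓ ^ ((7 : ℝ) / 2) := by
      gcongr
    have h2 : T * Lt * v * ℓ ^ ((7 : ℝ) / 2) = T * ℓ ^ (-A) := by
      have h3 : ℓ ^ (-(A + 7 / 2)) * ℓ ^ ((7 : ℝ) / 2) = ℓ ^ (-A) := by
        rw [← Real.rpow_add hℓ0]
        congr 1
        ring
      calc T * Lt * v * ℓ ^ ((7 : ℝ) / 2) = T * (Lt * Lt⁻¹) * (ℓ ^ (-(A + 7 / 2)) * ℓ ^ ((7 : ℝ) / 2)) := by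
            rw [hvdef]; ring
        _ = T * ℓ ^ (-A) := by rw [mul_inv_cancel₀ hLt0.ne', h3, mul_one]
    linarith
  -- term (iii): `ℓ^{5/2}/Lt · √(T Σ |ℓ(s)|²) ≤ T ℓ^6/Lt ≤ T ℓ^{-A}`
  have hcardT : (S.card : ℝ) ≤ T := hS.card_le' hT2
  have hsum : ∑ t ∈ S, ‖dividedDifference (classGroupLFunction K ψ) (1 / 2 + t * I)
      (1 / 2 + t' t * I)‖ ^ 2 ≤ T * ℓ ^ (7 : ℕ) := by
    have h72 : (ℓ ^ ((7 : ℝ) / 2)) ^ 2 = ℓ ^ (7 : ℕ) := by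
      rw [← Real.rpow_natCast (ℓ ^ ((7 : ℝ) / 2)) 2, ← Real.rpow_mul hℓ0.le]; norm_num
    calc ∑ t ∈ S, ‖dividedDifference (classGroupLFunction K ψ) (1 / 2 + t * I)
          (1 / 2 + t' t * I)‖ ^ 2 ≤ ∑ t ∈ S, (ℓ ^ ((7 : ℝ) / 2)) ^ 2 :=
          Finset.sum_le_sum fun t ht => pow_le_pow_left₀ (norm_nonneg _) (h11 t ht) 2
      _ = S.card * ℓ ^ (7 : ℕ) := by rw [Finset.sum_const, nsmul_eq_mul, h72]
      _ ≤ T * ℓ ^ (7 : ℕ) := by gcongr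
  have hterm3 : ℓ ^ ((5 : ℝ) / 2) / Lt * Real.sqrt (T * ∑ t ∈ S, ‖dividedDifference
      (classGroupLFunction K ψ) (1 / 2 + t * I) (1 / 2 + t' t * I)‖ ^ 2) ≤ T * ℓ ^ (-A) := by
    have h1 : Real.sqrt (T * ∑ t ∈ S, ‖dividedDifference (classGroupLFunction K ψ)
        (1 / 2 + t * I) (1 / 2 + t' t * I)‖ ^ 2) ≤ T * ℓ ^ ((7 : ℝ) / 2) := by
      rw [← Real.sqrt_sq (show (0 : ℝ) ≤ T * ℓ ^ ((7 : ℝ) / 2) by positivity)]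
      refine Real.sqrt_le_sqrt ?_
      have h72 : (ℓ ^ ((7 : ℝ) / 2)) ^ 2 = ℓ ^ (7 : ℕ) := by
        rw [← Real.rpow_natCast (ℓ ^ ((7 : ℝ) / 2)) 2, ← Real.rpow_mul hℓ0.le]; norm_num
      rw [mul_pow, h72]
      nlinarith [hsum, hT0]
    have h56 : ℓ ^ ((5 : ℝ) / 2) * ℓ ^ ((7 : ℝ) / 2) = ℓ ^ (6 : ℕ) := by
      rw [← Real.rpow_add hℓ0]; norm_num
    calc ℓ ^ ((5 : ℝ) / 2) / Lt * Real.sqrt (T * ∑ t ∈ S, ‖dividedDifference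
          (classGroupLFunction K ψ) (1 / 2 + t * I) (1 / 2 + t' t * I)‖ ^ 2)
        ≤ ℓ ^ ((5 : ℝ) / 2) / Lt * (T * ℓ ^ ((7 : ℝ) / 2)) :=
          mul_le_mul_of_nonneg_left h1 (by positivity)
      _ = T / Lt * ℓ ^ (6 : ℕ) := by rw [← h56]; field_simp
      _ ≤ T * ℓ ^ (-A) := hterm1
  -- assemble: `4C T ℓ^{-A} ≤ Σ ≤ C · 3 T ℓ^{-A}`
  have hup : ∑ t ∈ S, sincTerm t (t' t) ≤ C * (3 * (T * ℓ ^ (-A))) := by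
    refine h92.trans (mul_le_mul_of_nonneg_left ?_ hC.le)
    linarith
  have hpos : 0 < C * (T * ℓ ^ (-A)) := by positivity
  linarith

end ConreyIwaniec2002

open ConreyIwaniec2002 NumberField

/-- **Proposition 10.1 (weak exponent `2A+7`) from the typed Proposition 9.1 alone** — through the
tree's fact-free `conreyIwaniec2002_proposition92_weak_of_proposition91`.
[cite: ConreyIwaniec2002, Proposition 10.1] -/
theorem conreyIwaniec2002_proposition101_weak_of_proposition91 (h91 : conreyIwaniec2002_proposition91) :
    ∃ c : ℝ, 0 < c ∧
    ∀ A : ℝ, 0 ≤ A →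
      ∀ (q : ℕ) [NeZero q], 4 < q → Odd q → ∀ χ : DirichletCharacter ℂ q,
        χ.IsPrimitive → χ.IsQuadratic → χ.Odd →
          ∀ (K : Type) [Field K] [NumberField K],
            Module.finrank ℚ K = 2 → NumberField.discr K = -(q : ℤ) →
              ∀ (ψ : ClassGroup (𝓞 K) →* ℂˣ) (T α : ℝ) (S : Finset ℝ) (t' : ℝ → ℝ),
                2 ≤ T → 0 < α → α ≤ 1 → Real.log q ^ (A + 6) ≤ Real.log T →
                  IsPointSet S T →
                    (∀ t ∈ S, |t - t' t| ≤ gapRadius α t) →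
                      (∀ t ∈ S, ‖dividedDifference (classGroupLFunction K ψ)
                          (1 / 2 + t * I) (1 / 2 + t' t * I)‖ ≤ Real.log q ^ ((7 : ℝ) / 2)) →
                        c * T / (α * Real.log q ^ A) ≤ (S.card : ℝ) →
                          Real.log T ^ (-(2 : ℝ)) * Real.log q ^ (-(2 * A + 7)) ≤
                            ‖χ.LFunction 1‖ :=
  proposition101_weak_of_principalEstimate_weak (conreyIwaniec2002_proposition92_weak_of_proposition91 h91)

end Literature.NumberTheory.LFunctions

end
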